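import Mathlib
import HarnessLib
import HarnessLib.Audit
import Summits.CriticalPhenomena.Statement
import Literature.Probability.RandomPlanarGeometry.RestrictionHulls
import HarnessLib.Audit.Status.Attr

/-!
Route: SAWLoopFugacityFlow

DORMANT since 2026-08-26T04:21:15Z (reconciler: no traction for 8.3 d (last activity item-evidence-added at 2026-08-17T19:24:59Z); parked, not closed — `ledger route dormant route-CriticalPhenomena-SAWLoopFugacityFlow --off` to reactiva) — unstaffed, not closed; items shared with open routes are served there. `ledger route dormant <id> --off` reactivates.

# Route SAWLoopFugacityFlow — SAW = critical Ising with the loops switched off — continue the dilute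
Z2 loop model from n = 1 (free fermion) to n = 0 and read SLE(8/3) off the 5/8 avoidance law

It suffices to show X6 = (A) ∧ (T) ∧ (S) [idea card ising-anchored-loop-fugacity-flow: loop-fugacity
continuation anchored at the ℤ²-Ising free fermion + restriction closing]:
 (A) AvoidanceLimit — for every Dobrushin domain (D; a, b), every Dobrushin D' ⊆ D with the same
marked points agreeing with D near a and b (a hull subdomain: D' = φ(ℍ ∖ A) for a chordal
uniformizing map φ of (D; a, b) and the pulled-back hull A = closure (ℍ ∖ φ⁻¹(D')) ∈ 𝒬*, written
INLINE in the items since rev 2 and quantified as `∀ A, A = closure (ℍ ∖ {z ∈ ℍ | φ z ∈ D'}) → …` —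
this is Literature.Probability.RandomPlanarGeometry.ConformalEquiv.pullbackHull φ D' by `rfl`, whose
module HullSubdomainPullback is deliberately NOT imported by the route file) and EVERY endpoint
approximation (Literature.Probability.RandomPlanarGeometry.SAW.IsEndpointApprox), the critical δℤ²
SAW probability P_δ(γ ⊆ cl D') (law = Literature.Probability.RandomPlanarGeometry.SAW.law pushed to
CurveClass ℂ, event Literature.Probability.RandomPlanarGeometry.CurveClass.rangeSubset (closure D'))
converges as δ → 0+ to Φ'_A(0)^(5/8) (Φ_A the normalised restriction map,
Literature.Probability.RandomPlanarGeometry.IsRestrictionMap / HasRestrictionDeriv; this is the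
SLE_(8/3) value by LSW03 Thm 6.1 =
Literature.Probability.RandomPlanarGeometry.sle_restriction_eightThirds_holds, PROVED in the tree).
     The card's MECHANISM delivers (A) as the n = 0 end of a one-parameter identity. Along the
dilute NON-crossing loop model L_n on Ω_δ ⊆ δℤ² — edge subgraphs η with ∂η = {a_δ, b_δ}, degrees ≤
4, one of the two non-crossing pairings chosen at each degree-4 vertex, weight x^|η| · w^N₄(η) ·
n^#loops at the critical fugacity x = x_c(n, w) — which at (n, w) = (1, ½) IS the high-temperature
graph expansion of the free-b.c. critical Ising two-point function on Ω_δ (tanh β_c = √2 − 1;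
interfaces = CDHKS SLE₃, fermion s-holomorphic: ℤ² THEOREMS) and at (n, w) = (0, 0) IS
Literature.Probability.RandomPlanarGeometry.SAW.law (no loops, no degree-4 vertices, x_c = 1/μ), the
doubly normalised two-leg boundary ratio R_δ(n; D, D') = [Z_n(Ω'_δ; a,b)/Z_n(Ω'_δ)] / [Z_n(Ω_δ;
a,b)/Z_n(Ω_δ)] should converge to Φ'_A(0)^b(n), b = (6 − κ)/(2κ), n = −2cos(4π/κ): b(1) = 1/2 is the
typed n = 1 anchor IsingBoundaryRatio (boundary spin = weight-½ primary, ratio form), b(0) = 5/8 is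
(A). The passage n: 1 → 0 = a constructive fermionic-RG window at the free fermion (IsingWindow;
Grassmann/HT-contour representation of CGG arXiv:2408.12923, the loop weight made LOCAL by
orientation phases e^(±iα/4), 2cos α = n) + δ-uniform analyticity and local boundedness of n ↦
R_δ(n) on a complex neighbourhood of [0, 1] with Vitali/identity theorem (FugacityAnalyticity).
These two cruxes are filed INFORMAL (ranks 3, 4) until the definition DiluteLoopModel lands; route
path in the (n, w) plane: the diagonal w = n/2 (both ends are library objects), the card's L-path (w
≡ ½ then osculation irrelevance at n = 0) kept as the alternative.
 (T) EventualTight — eventual tightness of the pushed-forward critical SAW laws (shared item,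
verbatim stmt-CriticalPhenomena-1372).
 (S) SimpleSubseqLimits — every subsequential weak limit (along δ_n → 0+) of the SAW laws is carried
by simple chords from a to b in cl D meeting ∂D only at a, b.
Closing (supports, all typed over route items only — no Literature fact is a hypothesis since rev 2;
rev 3 = route-choice/route-repair): for a subsequential weak limit ν of the pushed-forward SAW laws,
AvoidancePassage (portmanteau sandwich over hull super-domains) turns (A) into ν(γ ⊆ cl D') =
μ_SLE(γ ⊆ cl D') (SLEAvoidanceValue: LSW Thm 6.1 transposed, sle_restriction_eightThirds_holds);
AvoidanceDeterminesLaw (verbatim stmt-CriticalPhenomena-1373: LSW03 Lemma 3.2 on simple chords) with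
the carriers (S) and SLECarrier gives ν = the chordal SLE_(8/3) law, i.e. every subsequential limit
is identified (this is SubseqIdentification, verbatim stmt-CriticalPhenomena-0783, kept wanted as
the hub-wide hinge but no longer a link of the deciding chain); tightness (T) + Prokhorov on the
Polish CurveClass ℂ + the subsequence principle along 𝓝[>]0 then give ConvergesInLawToSLE (8/3) =
SAWScalingLimit. Since rev 3 the identification glue and the tail are ONE provable-now item, the
Assembly := SLECarrier → SLEAvoidanceValue → AvoidanceLimit → EventualTight → SimpleSubseqLimits →
AvoidancePassage → AvoidanceDeterminesLaw → SAWScalingLimit (stmt-CriticalPhenomena-10724, shared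
verbatim with SAWSteinDefect, so one proof closes both tails); the separate rev-1/2 glue item
AvoidanceToIdentification is dropped (as a new rank-9 support it is rendered, in item-id order,
BEFORE the supports it quantifies over and cannot elaborate — gate render order), and the rev-2 want
of the named tail stmt-CriticalPhenomena-4538 is superseded (it carries a stale missing-decl block
from another route). ROUTE CHOICE (rev 3): the all-κ existence fact
Literature.Probability.RandomPlanarGeometry.exists_isSLECurve (which needs the SLE_8/UST trace
theorem, judged XL) is NOT an input of this line and appears in no item's constant cone — only κ =
8/3 is ever needed, where existence is the theorem exists_isSLECurve_eightThirds, used inside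
provers' proofs; it is therefore neither promoted to a crux nor wanted. Deciding theorem (certified
by the gate's native check: closes OK, axioms propext / Classical.choice / Quot.sound, cone 103
constants with no unproved closed fact): closes := fun hA hS _ _ hT hDet hPass hCar hVal hAsm ↦ hAsm
hCar hVal hA hT hS hPass hDet. Conformal covariance is OUTPUT: it enters only through the conformal
invariance of Φ'_A(0)^b(n), a theorem at n = 1, continued in n.
Lean: `(∀ (D D' : Literature.Probability.RandomPlanarGeometry.DobrushinDomain) (a b : ℝ →
Literature.Probability.LatticeModels.Site 2),
Literature.Probability.RandomPlanarGeometry.SAW.IsEndpointApprox D a b → D'.carrier ⊆ D.carrier →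
D'.pt 0 = D.pt 0 → D'.pt 1 = D.pt 1 → (∃ ε : ℝ, 0 < ε ∧ D'.carrier ∩ Metric.ball (D.pt 0) ε =
D.carrier ∩ Metric.ball (D.pt 0) ε ∧ D'.carrier ∩ Metric.ball (D.pt 1) ε = D.carrier ∩ Metric.ball
(D.pt 1) ε) → ∀ (φ : Literature.Probability.RandomPlanarGeometry.ConformalEquiv
UpperHalfPlane.upperHalfPlaneSet D.carrier), D.IsChordalUniformizing φ → ∀ (A : Set ℂ), A = closure
(UpperHalfPlane.upperHalfPlaneSet \ {z | z ∈ UpperHalfPlane.upperHalfPlaneSet ∧ φ z ∈ D'.carrier}) →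
∀ (Φ : Literature.Probability.RandomPlanarGeometry.ConformalEquiv (UpperHalfPlane.upperHalfPlaneSet
\ A) UpperHalfPlane.upperHalfPlaneSet) (d : ℝ),
Literature.Probability.RandomPlanarGeometry.IsRestrictionMap A Φ →
Literature.Probability.RandomPlanarGeometry.HasRestrictionDeriv A Φ d → Filter.Tendsto (fun δ =>
((Literature.Probability.RandomPlanarGeometry.SAW.law D.carrier δ (a δ) (b δ)).map (fun γ =>
γ.curve)) (Literature.Probability.RandomPlanarGeometry.CurveClass.rangeSubset (closure D'.carrier)))
(nhdsWithin 0 (Set.Ioi 0)) (nhds (ENNReal.ofReal (d ^ ((5 : ℝ) / 8))))) ∧ (∀ (D :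
Literature.Probability.RandomPlanarGeometry.DobrushinDomain) (a b : ℝ →
Literature.Probability.LatticeModels.Site 2),
Literature.Probability.RandomPlanarGeometry.SAW.IsEndpointApprox D a b → ∃ δ₀ : ℝ, 0 < δ₀ ∧
MeasureTheory.IsTightMeasureSet ((fun δ => (Literature.Probability.RandomPlanarGeometry.SAW.law
D.carrier δ (a δ) (b δ)).map (fun γ => γ.curve)) '' Set.Ioc 0 δ₀)) ∧ (∀ (D :
Literature.Probability.RandomPlanarGeometry.DobrushinDomain) (a b : ℝ →
Literature.Probability.LatticeModels.Site 2),
Literature.Probability.RandomPlanarGeometry.SAW.IsEndpointApprox D a b → ∀ (s : ℕ → ℝ) (ν :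
MeasureTheory.Measure (Literature.Probability.RandomPlanarGeometry.CurveClass ℂ)), Filter.Tendsto s
Filter.atTop (nhdsWithin 0 (Set.Ioi 0)) → MeasureTheory.IsProbabilityMeasure ν → (∀ f :
BoundedContinuousFunction (Literature.Probability.RandomPlanarGeometry.CurveClass ℂ) ℝ,
Filter.Tendsto (fun n => ∫ γ, f γ.curve ∂(Literature.Probability.RandomPlanarGeometry.SAW.law
D.carrier (s n) (a (s n)) (b (s n)))) Filter.atTop (nhds (∫ x, f x ∂ν))) → ∀ᵐ γ ∂ν, γ ∈
Literature.Probability.RandomPlanarGeometry.CurveClass.simple ∧ γ.source = D.pt 0 ∧ γ.target = D.pt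
1 ∧ γ.range ⊆ closure D.carrier ∧ γ.range ∩ frontier D.carrier ⊆ {D.pt 0, D.pt 1})`

## Assembly
Assembly := SLECarrier → SLEAvoidanceValue → AvoidanceLimit → EventualTight → SimpleSubseqLimits →
AvoidancePassage → AvoidanceDeterminesLaw → SAWScalingLimit (rev 3 = stmt-CriticalPhenomena-10724,
shared with SAWSteinDefect; rev 2 wanted the named tail EventualTight → SubseqIdentification →
SAWScalingLimit = stmt-CriticalPhenomena-4538 plus a separate glue item, rev 1 took the four
Literature facts CurveClass.polishSpace, IsSLECurve.map_eq, exists_isSLECurve,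
MarkedDomain.exists_isChordalUniformizing as hypotheses, which a deciding theorem cannot discharge
by name — the first, second and fourth are THEOREMS of the tree, polishSpace_holds /
IsSLECurve.map_eq_holds / MarkedDomain.exists_isChordalUniformizing_holds, and of the third only κ =
8/3 is relevant, a theorem too: exists_isSLECurve_eightThirds). Proof sketch (provable now, M): fix
(D; a, b) and an endpoint approximation; the laws are probability measures for all small δ
(IsEndpointApprox.reachable gives a SAW, x_c > 0 by SAW.criticalFugacity_pos_lt_one', DomainSAW
finite for bounded Ω and δ > 0); γ ↦ γ.curve is measurable (SAW.aemeasurable_curve); a chordal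
uniformizer φ exists (MarkedDomain.exists_isChordalUniformizing_holds), every pulled-back hull A =
closure (ℍ ∖ φ⁻¹(D')) is a *-hull with restriction data (Φ, d) (IsStarHull.pullbackHull,
IsStarHull.existsUnique_isRestrictionMap_holds / exists_hasRestrictionDeriv_holds), and the
SLE_(8/3) law μ of D exists (exists_isSLECurve_eightThirds). Identification of a subsequential limit
ν along s_n → 0+: pull AvoidanceLimit along s_n, rewrite its value by SLEAvoidanceValue,
AvoidancePassage gives ν = μ on all hull-subdomain avoidance events, SimpleSubseqLimits and
SLECarrier supply the carrier clauses, AvoidanceDeterminesLaw gives ν = μ (bookkeeping, S). Tail: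
EventualTight is literally the hypothesis hT of convergesInLawToSLE_of_isTightMeasureSet_image'
(SLEUniquenessInLaw.lean, PROVED; no existence fact needed there, the SLE curve comes out of the
identified limit law) and the identification just obtained is its clause hL (IsSubseqLimitLaw
unfolds to bounded-continuous-test-function convergence along s_n → 0+), whose only mismatch is the
instance hypothesis [∀ δ, IsProbabilityMeasure (P δ)] at junk meshes — re-run its 15-line proof with
'eventually a probability measure' (the index shift by N is already in
IsTightAlongMesh.exists_subseq) or transport to the modified family on CurveClass ℂ equal to the
pushed-forward laws eventually along 𝓝[>]0 (same plan as SAWParafermion.Assembly2,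
stmt-CriticalPhenomena-10209). With it the deciding theorem is closes := hAsm hCar hVal hA hT hS
hPass hDet.

Rationale: WHY THIS LINE. The de Gennes–Nienhuis n-continuation of the dilute O(n) loop model (Nienhuis1982;
square-lattice branches Blöte–Nienhuis doi:10.1088/0305-4470/22/9/028; Jacobsen, ch. 14 of
book:editornd-polygons-polyominoes-polycubes pp. 365–367: n is a formal complex parameter, locality
restored by oriented loops with turning phases, n = 2cos γ) has never been run on the one lattice
where its n = 1 member is a THEOREM with full conformal invariance: on ℤ² the dilute non-crossing
loop model with osculation weight ½ is exactly the Ising high-temperature graph expansion (pairing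
sum (½+½)^N₄ = 1), whose fermion is s-holomorphic and whose Dobrushin interfaces converge to SLE₃
(CDHKSCRAS2014, ChelkakHonglerIzyurov2015, Hongler–Kytölä doi:10.1090/s0894-0347-2013-00774-2 for
free b.c.), and whose non-integrable perturbations — including BOUNDARY spin correlations, via a
Grassmann representation built on the same high-temperature contours — are controlled by
constructive fermionic RG (GGM doi:10.1063/1.4745910, AGG doi:10.1007/s00220-022-04481-z,
Cava–Giuliani–Greenblatt arXiv:2408.12923; marginal lines near free fermions:
Benfatto–Falco–Mastropietro doi:10.1007/s00220-009-0888-z). Imported areas: constructive fermionic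
RG (the window near n = 1), complex analysis in the coupling (δ-uniform analyticity in n + Vitali,
the Lee–Yang/Coulomb-gas expectation that n is a 'topological', non-renormalising parameter along a
line of fixed points with c(n), b(n) analytic on (−2, 2)), and conformal restriction (LSW03, PROVED
in the tree: LawlerSchrammWerner2003_holds, sle_restriction_eightThirds_holds,
IsSLELaw.hullRestriction_eightThirds_holds) for the closing. What the line does that the sibling
routes do not: SAWConfRestriction/SAWRestrictionRigidity leave the conformal VALUE of avoidance
ratios as an axiom or a rigidity output, SAWParafermion needs an n = 0 observable on ℤ² (barrier
NienhuisWeightsExcludeVertexSAW), SAWHexUniversality moves across lattices, SAWQuantumGravity across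
environments; this route moves across n on the fixed lattice ℤ² from the point where ℤ² is solved,
and types both ends of the identity (IsingBoundaryRatio at n = 1, AvoidanceLimit at n = 0) so
provers can work while DiluteLoopModel is requested. Vs the sibling card
charge-continuation-from-lerw-lambda-saw: other anchor (c = ½, κ ↓ 8/3 vs c = −2, κ ↑ 8/3), other
parameter (fugacity of a LOCAL vertex model vs loop-soup charge), nothing shared but the SAW
endpoint.

RANKED CRUXES. #2 AvoidanceLimit (crux) — (A) above — the n = 0 endpoint and typed face of the
continuation: for every Dobrushin D, hull subdomain D' (same marked points, agreeing with D in balls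
around a and b), endpoint approximation (a_δ, b_δ), chordal uniformizing φ : ℍ → D and restriction
data (Φ, d = Φ'_A(0)) of the pulled-back hull A = closure (ℍ ∖ φ⁻¹(D')) (quantified as ∀ A, A =
closure (ℍ ∖ {z ∈ ℍ | φ z ∈ D'}) → …; = φ.pullbackHull D' by rfl), P_δ(range γ_δ ⊆ closure D') →
d^(5/8) as δ → 0+ (ENNReal.ofReal). Lattice meaning: Z_0(Ω'_δ; a,b)/Z_0(Ω_δ; a,b) up to walks
touching ∂D' ∩ D (expected o(1); part of the crux), largest-component bookkeeping. Value-ful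
strengthening of SAWRestrictionRigidity.AvoidanceCocycleLimit (stmt-CriticalPhenomena-1369,
value-free); LSW04 Prediction (restriction exponent 5/8). Delivered in this route by
IsingBoundaryRatio → IsingWindow → FugacityAnalyticity (layer 2, see Two-layer plan); directly
attackable too. [deps: IsingBoundaryRatio] [difficulty: open-problem] (why it might fail: Value AND
existence for EVERY IsEndpointApprox: endpoints at mesoscopic depth (Kennedy–Lawler lattice effects)
or boundary-touching walks (closed event vs Z(Ω'_δ)/Z(Ω_δ)) could shift the limit; behind it, the
n-continuation may hit a transition in n ∈ (0,1) on ℤ².) [LawlerSchrammWerner2004SAW,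
LawlerSchrammWerner2003Restriction, KennedyLawler2013, Nienhuis1982, doi:10.1088/0305-4470/22/9/028,
Cardy2005SLE, arXiv:2408.12923]
#5 SimpleSubseqLimits (crux) — (S): for every Dobrushin domain, endpoint approximation, sequence s_n
→ 0+ and probability measure ν on CurveClass ℂ that is the weak limit of the pushed-forward SAW laws
along s_n, ν-a.e. curve class is simple, runs from a = D.pt 0 to b = D.pt 1, has range in closure D
and meets ∂D only at a, b (exactly the carrier clause of AvoidanceDeterminesLaw). Subsequential form
of SAWConfRestriction.SimpleOfLimit (0774). Foreseen split: 'range is a simple boundary-avoiding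
arc' (follows from AvoidanceLimit + LSW Lemma 3.2 on filled ranges + SLE_(8/3) simplicity) ∧ 'no
retracing' (a near-self-approach estimate for x_c-SAW). [difficulty: open-problem] (why it might
fail: Weak limits of simple polylines need not be simple, non-retracing or boundary-avoiding: needs
no-macroscopic-self-approach and no-boundary-crawling bounds at x_c under every IsEndpointApprox;
only sub-ballisticity is in print.) [LawlerSchrammWerner2004SAW, KennedyLawler2013,
DuminilCopinHammond2013, arXiv:2310.17299, AizenmanBurchardDuke1999]
#6 IsingBoundaryRatio (crux) — the n = 1 ANCHOR, typed: for D, D', (a_δ, b_δ) an endpoint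
approximation in BOTH Ω_δ and Ω'_δ, φ, Φ, d as in AvoidanceLimit, the ratio of
free-boundary-condition critical Ising boundary two-point functions ⟨σ_(a_δ) σ_(b_δ)⟩^free_(Ω'_δ) /
⟨σ_(a_δ) σ_(b_δ)⟩^free_(Ω_δ) (Literature.Probability.LatticeModels.isingTwoPoint on
discreteDomainGraph, volume = the mesh-domain finset written inline (= PlanarIsing.meshDomainFinset
by rfl), β = ½ log(1+√2) inline (= criticalBetaTwo by rfl), h = 0, BoundaryCondition.free, the
LocallyFinite structure quantified as a family lf (a subsingleton) — so PlanarIsing.lean with its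
refuted CHI records stays out of the imports; rev-1/rev-2 forms proved equivalent in the planner's
SketchDefEq.lean) converges to d^(1/2) as δ → 0+. By the high-temperature expansion ⟨σ_a σ_b⟩^free =
Z_1(Ω_δ; a,b)/Z_1(Ω_δ) (tanh β_c = √2 − 1), so this IS lim R_δ(1; D, D') = Φ'_A(0)^b(1), b(1) = 1/2:
the boundary spin is a weight-½ boundary primary in chordal normalisation (other point at ∞ under
Φ_A(z) ∼ z). By Kramers–Wannier it is also the ratio of dual Dobrushin-interface partition functions
(CDHKS setting). GKS: ratio ≤ 1, consistent with d^(1/2) ≤ 1. The first crux provers can attack now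
(free-b.c. fermionic observables: Hongler–Kytölä, BDH16; exact half-plane asymptotics McCoy–Wu ch.
VII; non-integrable half-plane version CGG24). [difficulty: L] (why it might fail: Printed free-b.c.
results (Hongler–Kytölä 2013, BDH 2016, CGG 2024 half-plane) do not state this nested-domain RATIO
for general Jordan D with endpoints possibly at mesoscopic depth; the local endpoint factors must
cancel between D and D'.) [doi:10.1090/s0894-0347-2013-00774-2, doi:10.1214/15-aihp698,
arXiv:2408.12923, ChelkakHonglerIzyurov2015, CDHKSCRAS2014, MccoyWu1973]
#9 EventualTight (support) — (T), verbatim the shared item stmt-CriticalPhenomena-1372: for every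
Dobrushin domain and endpoint approximation there is δ₀ > 0 with {(law D δ a_δ b_δ).map curve : δ ∈
(0, δ₀]} tight — the repaired (∃ δ₀) form of the refuted all-δ stmt-CriticalPhenomena-0772. Tools:
Aizenman–Burchard / Kemppainen–Smirnov Condition G2 at x_c (not in print); load-bearing for the
Assembly, believed open, support because shared and value-free. [difficulty: open-problem]
[KemppainenSmirnov2017, AizenmanBurchardDuke1999, DuminilCopinHammond2013]
#9 AvoidanceDeterminesLaw (support) — verbatim the shared item stmt-CriticalPhenomena-1373: two
probability measures on CurveClass ℂ carried by simple chords of D from a to b meeting ∂D only at a,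
b that give the same mass to {range ⊆ closure D'} for every hull subdomain D' (same marked points,
agreeing with D near a, b) are equal (curve-space LSW03 Lemma 3.2; in tree cf.
CurveClass.Measure.ext_of_missCode_injOn). [difficulty: M] [LawlerSchrammWerner2003Restriction,
AizenmanBurchardDuke1999]
#9 SubseqIdentification (support) — verbatim the shared item stmt-CriticalPhenomena-0783 (a crux of
SAWParafermion): every subsequential weak limit of the critical SAW laws in (Ω_δ; a_δ, b_δ) is the
chordal SLE_(8/3) law of (D; a, b); implied by the avoidance cruxes + supports (the identification
half of the Assembly); kept wanted as the hub-wide hinge, not a link of closes since rev 3.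
[difficulty: open-problem] [LawlerSchrammWerner2004SAW, LawlerSchrammWerner2003Restriction]
#9 AvoidancePassage (support) — portmanteau sandwich: if ν is the weak limit of the pushed-forward
SAW laws along s_n → 0+, μ the chordal SLE_(8/3) law of D, and along s_n the SAW avoidance
probabilities of EVERY hull subdomain D'' converge to μ(range ⊆ closure D''), then ν(range ⊆ closure
D') = μ(range ⊆ closure D') for every hull subdomain D'. '≥': closed event
(CurveClass.isClosed_rangeSubset); '≤': outer approximation by hull super-domains D'_k with cl D'_k
↓ cl D' (shrink the *-hull in ℍ), open events rangeSubset(U_k) (isOpen_rangeSubset), lattice curves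
in cl D, continuity from above of μ (or of Φ'_A(0), LSWConverges.tendsto_restrictionDeriv). Provable
now. [difficulty: M] [LawlerSchrammWerner2003Restriction, AizenmanBurchardDuke1999]
#9 SLECarrier (support) — the chordal SLE_(8/3) law of a Dobrushin domain is a probability measure
carried by simple curve classes from a to b with range in closure D meeting ∂D only at a, b
(Rohde–Schramm simplicity for κ ≤ 4, transience, boundary avoidance; in tree
IsSLELaw.isProbabilityMeasure / ae_simple / ae_endpoints, chordalCarrier lemmas). [difficulty:
provable-now] [RohdeSchramm2005, LawlerSchrammWerner2003Restriction, Lawler2005]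
#9 SLEAvoidanceValue (support) — LSW03 Thm 6.1 transposed to hull subdomains in the ε-ball form used
here: for μ the chordal SLE_(8/3) law of D, D' ⊆ D agreeing with D near a, b, φ chordal
uniformizing, Φ the restriction map of the pulled-back hull A = closure (ℍ ∖ φ⁻¹(D')) (inline; =
φ.pullbackHull D' by rfl) with derivative d, μ(range ⊆ closure D') = ofReal(d^(5/8)) (in tree:
sle_restriction_eightThirds_holds + HullRestrictionNull + IsStarHull.pullbackHull). A grounder's
candidate proof of the rev-1 form is attached to stmt-CriticalPhenomena-4986
(SLEAvoidanceValueCandidate.lean, rc0; rev-2 form after `intro … A hA; subst hA`). [difficulty: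
provable-now] [LawlerSchrammWerner2003Restriction]
#1 Assembly (assembly; rev 3 = stmt-CriticalPhenomena-10724, shared verbatim with SAWSteinDefect) —
SLECarrier → SLEAvoidanceValue → AvoidanceLimit → EventualTight → SimpleSubseqLimits →
AvoidancePassage → AvoidanceDeterminesLaw → SAWScalingLimit: the identification glue (given a
subsequential limit ν along s_n: chordal uniformizer by
MarkedDomain.exists_isChordalUniformizing_holds, restriction data of the pulled-back *-hulls by
IsStarHull.pullbackHull + existsUnique_isRestrictionMap_holds / exists_hasRestrictionDeriv_holds,
SLE_(8/3) law by exists_isSLECurve_eightThirds — all THEOREMS; AvoidanceLimit + SLEAvoidanceValue +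
AvoidancePassage give ν = μ_SLE on hull-avoidance events, SimpleSubseqLimits + SLECarrier the
carriers, AvoidanceDeterminesLaw ν = μ_SLE; S) folded together with the Prokhorov tail
(convergesInLawToSLE_of_isTightMeasureSet_image', PROVED, on an eventually-equal probability-valued
family; M). The separate rev-1/2 glue item AvoidanceToIdentification is dropped: filed as a rank-9
support it is rendered (item-id string order) before AvoidanceDeterminesLaw / AvoidancePassage /
SLECarrier and cannot elaborate. [difficulty: M] [LawlerSchrammWerner2003Restriction,
LawlerSchrammWerner2004SAW, BillingsleyCPM1999]

TWO-LAYER PLAN. AvoidanceLimit ⇐ IsingWindow → FugacityAnalyticity → AvoidanceLimit (k = 2;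
IsingBoundaryRatio is the n = 1 instance inside IsingWindow's conclusion). Glue in words:
IsingWindow gives, for n ∈ (1 − ε₀, 1], lim_δ R_δ(n; D, D') = Φ'_A(0)^b(n) with b(n) = (6 −
κ(n))/(2κ(n)), κ(1 − ε) = 3 − (9/(4π√3))·ε + O(ε²); FugacityAnalyticity gives a complex
neighbourhood U ⊇ [0, 1] on which n ↦ R_δ(n) (a ratio of polynomials in n once x_c(n, w(n)) is
continued) is zero-free/analytic and locally bounded UNIFORMLY in δ ≤ δ₀; Vitali ⇒ R_δ converges
locally uniformly on U to an analytic R; identity theorem with the window ⇒ R(n) = Φ'_A(0)^b(n) on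
U; at n = 0, R_δ(0) = P_δ(γ ⊆ cl D') up to boundary-touching walks ⇒ AvoidanceLimit. Both children
are INFORMAL items (ranks 3, 4) until the definition DiluteLoopModel lands; then a glued split
(`route edit --split AvoidanceLimit`). Foreseen further: SimpleSubseqLimits ⇐ (simple
boundary-avoiding RANGE, from AvoidanceLimit + filled-range Lemma 3.2 + SLE simplicity) ∧ (no
retracing); EventualTight ⇐ KS Condition G2 at x_c (shared with SAWParafermion.KSConditionG2).

KILL CRITERIA. ¬AvoidanceLimit with a DIFFERENT limit value for some hull subdomain (or along some
endpoint approximation) refutes LSW04's restriction prediction as typed and closes this route (and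
breaks SAWRestrictionRigidity's engine); non-existence of the limit only for pathological
approximations ⇒ restate with boundary-vertex endpoints (pivot, shared with EndpointRobust of
SAWConfRestriction). Transfer-matrix/numerical evidence of a phase transition IN n on (0, 1) for the
square-lattice dilute non-crossing family (first-order jump of x_c(n, n/2), dense-branch takeover,
complex-n zeros of strip partition functions pinching (0, 1] as the width grows) kills
FugacityAnalyticity; if it survives on another positive path w(n) the route is edited, else closed
refuted-in-mechanism with the numerics as census. ¬IsingBoundaryRatio as typed (approximation
dependence at n = 1 already) ⇒ restate both endpoint statements with boundary-vertex endpoints; a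
wrong EXPONENT at n = 1 (≠ 1/2) closes the route. ¬SimpleSubseqLimits / ¬EventualTight refute the
conjunct itself (all routes), not this line.

NOT DECOMPOSED YET. Everything inside the two informal cruxes: for IsingWindow — the
Grassmann/HT-contour representation of the ORIENTED loop vertex model with the phase e^(±iα/4) as a
local quartic-free perturbation, the flow of the marginal loop-weight direction (line of fixed
points vs runaway), analyticity of exponents in ε = 1 − n, and the passage from correlation
asymptotics to the RATIO statement in Jordan domains; for FugacityAnalyticity — continuation of
x_c(n, w) off the real axis, a Lee–Yang-type zero-free region for Z_n(Ω_δ) and Z_n(Ω_δ; a, b)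
uniform in δ, local bounds, Vitali, and commutation of n → 0 with δ → 0 at the boundary point n = 0.
The card's alternative L-path (w ≡ ½ down to n = 0, then OsculationIrrelevance: osculating walk with
contact weight ½ and strict SAW share the chordal limit, 4-leg exponent x₄ = 35/12 > 2) is not
filed; it becomes a third child only if the diagonal path fails numerically. Lattice bookkeeping
inside AvoidanceLimit (largest component of Ω'_δ vs walks of Ω_δ staying in cl D', boundary-touching
walks) and inside IsingBoundaryRatio (volume = meshDomainFinset, free b.c.) is left to grounders. No
Target decl (X6 = AvoidanceLimit ∧ EventualTight ∧ SimpleSubseqLimits).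

CHEAPEST FALSIFIER. Strip transfer matrices (kit, minutes): for the square-lattice dilute
non-crossing loop model with w = n/2 (and w = ½ as control) at n = 1, 0.75, 0.5, 0.25, 0 on strips
of width ≤ 12, locate x_c(n, w) by phenomenological RG and read the effective central charge c(n)
and boundary one-leg exponent b(n) from finite-size gaps; the line dies if (c, b) leave the dilute
Coulomb-gas curve c = (3κ−8)(6−κ)/(2κ), b = (6−κ)/(2κ), n = −2cos(4π/κ) between the exactly known
ends (n = 1: c = ½, b = ½; n = 0: c = 0, b = 5/8), or if x_c jumps (first order / dense takeover);
the complex-n zeros of the width-L strip partition functions nearest to (0, 1] falling towards the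
segment as L grows kill FugacityAnalyticity specifically. No kit job yet (refuter's first move; the
route review adds Guo–Blöte–Nienhuis cond-mat/9812269: the n = 0 square-lattice loop model is
ordinary-SAW-critical for collision weight < 0.4 — no dense takeover indicated along w = n/2).
Lookup falsifier done: no printed theorem places a non-dilute phase on this family for n ∈ (0, 1)
(Blöte–Nienhuis 1989 branches are for the integrable weights; Taggi 2018 / DGPS 2020 are hexagonal).

NUMBERS. x_c(1, ½) = tanh β_c = √2 − 1 = 0.414214 (β_c = ½ log(1 + √2) =
Literature.Probability.LatticeModels.criticalBetaTwo); x_c(0, 0) = 1/μ(ℤ²), μ ∈ [2.6, 2.7]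
(SAW.LawlerSchrammWerner2004SAW_connectiveConstant_bounds), μ ≈ 2.63816; dilute branch n =
−2cos(4π/κ), κ ∈ [8/3, 4]: κ(1) = 3, κ(0) = 8/3, dκ/dn at n = 1 = 9/(4π√3) = 0.41350; boundary
one-leg weight b = h_(2,1) = (6 − κ)/(2κ): ½ → 5/8; central charge c = (3κ − 8)(6 − κ)/(2κ): ½ → 0;
SAW boundary exponent 5/8 and bulk 4-leg x₄ = 35/12 (Cardy2005SLE §5.3, §2.4.2); half-plane boundary
spin decay at T_c: ⟨σ₀σ_N⟩ ∼ N^(−1) = N^(−2b(1)) (MccoyWu1973 ch. VII).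

DEFINITION REQUESTS. DiluteLoopModel (topic Literature/Probability/LatticeModels, next to
SelfAvoidingWalk): for Ω_δ = discreteDomainGraph Ω δ, parameters (n w x : ℝ or ℂ) and optional
sources a, b : Site 2 — configurations = finite edge sets η of Ω_δ with deg_η(v) ∈ {0, 2, 4} off the
sources and odd at the sources, together with a choice of NON-crossing pairing of the four
half-edges at every degree-4 vertex (cyclic order E, N, W, S from the ℤ² embedding; the pairing {EW,
NS} excluded); loops(η, pairing) = number of closed strands of the resolved 2-regular structure;
Z_(n,w,x)(Ω_δ) = Σ x^|η| w^N₄ n^loops over source-free configurations, Z_(n,w,x)(Ω_δ; a, b) the same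
with sources; sanity lemmas wanted with it: Z_(1,½,x)(Ω_δ; a, b)/Z_(1,½,x)(Ω_δ) = isingTwoPoint …
free a b at tanh β = x (high-temperature expansion), and Z_(0,0,x)(Ω_δ; a, b) = Σ_(γ : DomainSAW)
x^|γ| (so that the n = 0 two-leg ratio is the SAW.law avoidance probability up to bookkeeping); the
critical fugacity x_c(n, w) as the radius of convergence of the half-plane two-leg susceptibility.
Cite facts wanted (kind cite): CGG24 Thm 1 (half-plane boundary spin scaling limit,
arXiv:2408.12923); Hongler–Kytölä 2013 free-b.c. observables (doi:10.1090/s0894-0347-2013-00774-2).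

IMPORT CONE (rev 2 route-repair; rev 3 route-choice). The route file imports only the summit
Statement and Literature.Probability.RandomPlanarGeometry.RestrictionHulls (all its named facts
carry `_holds`); HullSubdomainPullback (drags in CritPercSLE's unproved, irrelevant facts) and
PlanarIsing (refuted CHI records, unproved onsager_yang) were dropped at rev 2 by inlining. ROUTE
CHOICE (rev 3): the all-κ existence fact
Literature.Probability.RandomPlanarGeometry.exists_isSLECurve (incl. the κ = 8 / UST trace theorem;
judged XL) is NOT promoted to a crux and is NOT an input of the line: it entered only as an
antecedent of the rev-1 glue/assembly; only κ = 8/3 matters, where existence is the THEOREM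
exists_isSLECurve_eightThirds (used inside proofs, never as an item hypothesis), and the Prokhorov
tail obtains its SLE_(8/3) curve from the identified limit law
(convergesInLawToSLE_of_isTightMeasureSet_image', proved). Cone after rev 3 (#h21_route_deps, gate
native check): 103 constants, no closed fact without `_holds` besides the Statement itself,
exists_isSLECurve absent. The line rests on theorems only (sle_restriction_eightThirds_holds,
IsSLELaw.hullRestriction_eightThirds_holds, LawlerSchrammWerner2003_holds, hasSLETrace_eightThirds,
exists_isSLECurve_eightThirds, IsSLECurve.map_eq_holds, CurveClass.polishSpace_holds,
MarkedDomain.exists_isChordalUniformizing_holds, the IsStarHull restriction-map facts; proof-side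
imports stay outside the items' cone). The open NAMED inputs of the mechanism are the informal
cruxes IsingWindow / FugacityAnalyticity (awaiting the definition DiluteLoopModel) and the cite
requests CGG24 Thm 1 (arXiv:2408.12923), Hongler–Kytölä 2013 (doi:10.1090/s0894-0347-2013-00774-2).

Novelty: Searches (2026-08-15, this seat): `lit frontier CriticalPhenomena --since 2020` (30 descendants;
loop-model entries arXiv:2602.12000, arXiv:2606.00945, arXiv:2605.30030 — none on n-continuation
from Ising on ℤ²); `lit bridges CriticalPhenomena --cross any` (Peled–Spinka arXiv:1708.00058 the
only O(n) bridge); `lit galaxy search "O(n) model on the square lattice" --star all` (4: Jacobsen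
ch. 14 = book:editornd-polygons-polyominoes-polycubes, READ pp. 365–367; Vernier–Jacobsen–Saleur
arXiv:1406.1353; arXiv:1509.02804), `… "dilute loop model"` (2: Les Houches 2008 volume), `…
"analytic continuation in the loop fugacity"` (0); `lit vsearch` of the mechanism in prose (8 books:
Madras–Slade, Slade, Janse van Rensburg — classical n → 0 only); `lit search --hybrid "boundary spin
correlations free boundary conditions critical Ising"` (8; Duminil-Copin Ensaios
paper:galaxy-pdf-976184500 held); crossref: doi:10.1088/0305-4470/22/9/028 (Blöte–Nienhuis 1989),
doi:10.1088/0305-4470/26/15/023 (Batchelor 1993), doi:10.1088/0305-4470/19/13/025 (Karowski–Rys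
1986), doi:10.1214/18-ecp189 (Taggi 2018), doi:10.4171/jems/1012 (DGPS 2020),
doi:10.1007/s00220-016-2815-4, doi:10.1063/1.4745910 (GGM 2012), doi:10.1007/s00220-022-04481-z (AGG
2022), arXiv:2408.12923 (CGG 2024, READ pp. 1–4), doi:10.1007/s00222-018-00851-4 (ADTW 2019),
doi:10.1090/s0894-0347-2013-00774-2 (Hongler–Kytölä 2013), doi:10.1214/15-aihp698 (BDH 2016),
doi:10.1214/18-aop1301; local searchd FTS intermittently unavailable (connec  [refs: 10.1088/0305-4470/22/9/028, 10.1088/0305-4470/26/15/023, 10.1088/0305-4470/19/13/025, 10.1214/18-ecp189, 10.4171/jems/1012, 10.1007/s00220-016-2815-4, 10.1063/1.4745910, 10.1007/s00220-022-04481-z, 10.1007/s00222-018-00851-4, 10.1090/s0894-0347-2013-00774-2, 10.1214/15-aihp698, 10.1214/18-aop1301, 10.1007/s00220-009-0888-z, 2602.12000, 2606.00945, 2605.30030, 1708.00058, 1406.1353, 1509.02804, 240]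

Barriers (technique_class: loop-fugacity-deformation, rigorous-rg, conformal-restriction): - technique_class: loop-fugacity-deformation, rigorous-rg, conformal-restriction
- Literature.Barriers.CriticalPhenomena.RigorousRGSmallParameter: applies in spirit (rigorous RG
needs a small parameter at a free point) — the free point here is the ℤ² Ising free FERMION
(Grassmann/HT-contour representation of GGM/CGG, not the Gaussian field of the long-range barrier)
and the small parameter ε = 1 − n is used only inside IsingWindow; the endpoint ε = 1 is NOT claimed
perturbatively but by analyticity in n (FugacityAnalyticity), which is exactly where the line may
fail; no fixed point is constructed except from its neighbour on the line.
- Literature.Barriers.CriticalPhenomena.RigorousRGSmallParameterNarrow: same reading; no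
ε-below-marginality / long-range device is used; the marginal direction (the loop-weight phase,
c_eff = 1) is to be handled BFM-style as a line of fixed points indexed by n, not as an irrelevant
perturbation — honest caveat: the free-fermion point may not be the right expansion point for a
c-changing deformation.
- Literature.Barriers.CriticalPhenomena.WeaklySAWFourDimLogCorrections: outside its class — no
Gaussian/4D expansion point, no weakly-SAW coupling flow; the SAW is reached as the n = 0 member of
a planar loop family at fixed d = 2.
- Literature.Barriers.CriticalPhenomena.ParafermionicHalfCauchyRiemann: evaded — no parafermionic
observable is used for n ≠ 1; at n = 1 full s-holomorphicity of the ℤ² Ising fermion is a theorem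
(the barrier's evasion (i

Novelty grade: new-combination — ROUTE REVIEW (refuter rreview-5065e3d8, 08-15). Grade = card audit's new-combination, confirmed on reading: (de Gennes–Nienhuis n-continuation of the dilute loop model) + (constructive fermionic RG at the Z² free fermion, GGM/CGG) + (LSW03 restriction closing, proved in tree); searchd down (rc75), c (refuter refuter-rreview-route-CriticalPhenomena--5065e3d8-0, 2026-08-15T14:01:23Z; prior: Nienhuis1982, doi:10.1088/0305-4470/22/9/028, arXiv:cond-mat/9812269, arXiv:cond-mat/9812270, arXiv:2408.12923, doi:10.1063/1.4745910, LawlerSchrammWerner2003Restriction, LawlerSchrammWerner2004SAW)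

History (route lifecycle, newest last):
- 2026-08-15T11:43:14Z · rev 1: dropped stmt-CriticalPhenomena-5079 — duplicate of stmt-CriticalPhenomena-5063: the informal crux FugacityAnalyticity was filed twice (first CLI output truncated); keep 5063 (rank 3), drop 5079 (planner-plancard-CriticalPhenomena-SAWScaling-db3d6d3d-0)
- 2026-08-15T16:20:18Z · rev 2: restated AvoidanceLimit (stmt-CriticalPhenomena-4981), IsingBoundaryRatio (stmt-CriticalPhenomena-4983), SLEAvoidanceValue (stmt-CriticalPhenomena-4986), AvoidanceToIdentification (stmt-CriticalPhenomena-4987), Assembly (stmt-CriticalPhenomena-4988) — route-repair (rbadge g4): deciding theorem supplied + import  (planner-rbadge-CriticalPhenomena-SAWLoopFugaci-74038e98-g4-0)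
- 2026-08-15T16:49:22Z · rev 2: dropped AvoidanceToIdentification — route-choice (rchoice-78e252dc) rev 3: RE-ROUTED — Literature.Probability.RandomPlanarGeometry.exists_isSLECurve (all κ, XL) is neither promoted nor wanted: it (planner-rchoice-CriticalPhenomena-SAWLoopFugac-78e252dc-0)
- 2026-08-15T16:52:14Z · rev 2: dropped AvoidanceToIdentification — route-choice (rchoice-78e252dc) rev 3: RE-ROUTED — Literature.Probability.RandomPlanarGeometry.exists_isSLECurve (all κ, XL) is neither promoted nor wanted: it (planner-rchoice-CriticalPhenomena-SAWLoopFugac-78e252dc-0)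
- 2026-08-15T16:53:45Z · rev 2: dropped AvoidanceToIdentification — route-choice (rchoice-78e252dc) rev 3: RE-ROUTED — Literature.Probability.RandomPlanarGeometry.exists_isSLECurve (all κ, XL) is neither promoted nor wanted: it (planner-rchoice-CriticalPhenomena-SAWLoopFugac-78e252dc-0)
- 2026-08-26T04:21:15Z · DORMANT — reconciler: no traction for 8.3 d (last activity item-evidence-added at 2026-08-17T19:24:59Z); parked, not closed — `ledger route dormant route-CriticalPhenomen (operator:999:2231452)

sub-problem: SAWScalingLimit · status: dormant · opened planner-plancard-CriticalPhenomena-SAWScaling-db3d6d3d-0 2026-08-15T11:38:49Z · rev 8 · ledger route-CriticalPhenomena-SAWLoopFugacityFlow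
GENERATED by the gate from the ledger (D-0016/17). Provers cite these decls: `theorem foo : Summit.CriticalPhenomena.SAWScalingLimit.Theses.SAWLoopFugacityFlow.<Decl> := …` in Summits/CriticalPhenomena/SAWScalingLimit/Theorems/<Name>.lean.
-/

namespace Summit.CriticalPhenomena.SAWScalingLimit.Theses.SAWLoopFugacityFlow

open scoped BigOperators Topology Manifold Classical MeasureTheory ProbabilityTheory Matrix InnerProductSpace ComplexConjugate ContinuousMap
open Filter Set Function TopologicalSpace MeasureTheory

attribute [summit_statement] _root_.SAWScalingLimit

-- earlier AvoidanceLimit (stmt-CriticalPhenomena-4981, replaced 2026-08-15T16:20:18Z -> stmt-CriticalPhenomena-10649): open — ∀ (D D' : Literature.Probability.RandomPlanarGeometry.DobrushinDomain) (a b : ℝ → Literature.Probability.LatticeModels.Site 2), Literature.Probability.RandomPlanarGeometry.SAW.IsEndpointApprox D a b → D'.carrier ⊆ D.carrier → D'.pt 0 = D.pt 0 → D'.pt 1 = D.pt 1 → (∃ ε : ℝ, 0 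
/-- item stmt-CriticalPhenomena-10649 · crux · rank 2 · open · by planner
why it might fail: Value AND existence for EVERY IsEndpointApprox: endpoints at mesoscopic depth (Kennedy–Lawler lattice effects) or boundary-touching walks (closed event vs Z(Ω'_δ)/Z(Ω_δ)) could shift the limit; behind it, the n-continuation may hit a transition in n ∈ (0,1) on ℤ².
sources: LawlerSchrammWerner2004SAW, LawlerSchrammWerner2003Restriction, KennedyLawler2013, Nienhuis1982, doi:10.1088/0305-4470/22/9/028, Cardy2005SLE
[crux] (A) — the n = 0 endpoint and typed face of the continuation (rev 2: the pulled-back hull A =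
closure (ℍ ∖ φ⁻¹(D')) is written inline and quantified as `∀ A, A = closure (ℍ ∖ {z ∈ ℍ | φ z ∈ D'})
→ …`; it is ConformalEquiv.pullbackHull φ D' by rfl, so HullSubdomainPullback is not imported;
PROVED equivalent to the rev-1 item stmt-CriticalPhenomena-4981 in the planner's SketchDefEq.lean):
for every Dobrushin D, hull subdomain D' (same marked points, agreeing with D in balls around a and
b), endpoint approximation (a_δ, b_δ), chordal uniformizing φ : ℍ → D and restriction data (Φ, d =
Φ'_A(0)) of A, P_δ(range γ_δ ⊆ closure D') → d^(5/8) as δ → 0+ (ENNReal.ofReal). Lattice meaning: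
Z_0(Ω'_δ; a,b)/Z_0(Ω_δ; a,b) up to walks touching ∂D' ∩ D (expected o(1); part of the crux) and
largest-component bookkeeping. Value-ful strengthening of
SAWRestrictionRigidity.AvoidanceCocycleLimit (stmt-CriticalPhenomena-1369, value-free); LSW04
Prediction (restriction exponent 5/8). Delivered in this route by IsingBoundaryRatio → IsingWindow →
FugacityAnalyticity (layer 2, see Two-layer plan); directly attackable too. [deps:
IsingBoundaryRatio] [difficulty: open-problem] -/
@[route_item "route-CriticalPhenomena-SAWLoopFugacityFlow", crux]
def AvoidanceLimit : Prop :=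
  ∀ (D D' : Literature.Probability.RandomPlanarGeometry.DobrushinDomain) (a b : ℝ → Literature.Probability.LatticeModels.Site 2), Literature.Probability.RandomPlanarGeometry.SAW.IsEndpointApprox D a b → D'.carrier ⊆ D.carrier → D'.pt 0 = D.pt 0 → D'.pt 1 = D.pt 1 → (∃ ε : ℝ, 0 < ε ∧ D'.carrier ∩ Metric.ball (D.pt 0) ε = D.carrier ∩ Metric.ball (D.pt 0) ε ∧ D'.carrier ∩ Metric.ball (D.pt 1) ε = D.carrier ∩ Metric.ball (D.pt 1) ε) → ∀ (φ : Literature.Probability.RandomPlanarGeometry.ConformalEquiv UpperHalfPlane.upperHalfPlaneSet D.carrier), D.IsChordalUniformizing φ → ∀ (A : Set ℂ), A = closure (UpperHalfPlane.upperHalfPlaneSet \ {z | z ∈ UpperHalfPlane.upperHalfPlaneSet ∧ φ z ∈ D'.carrier}) → ∀ (Φ : Literature.Probability.RandomPlanarGeometry.ConformalEquiv (UpperHalfPlane.upperHalfPlaneSet \ A) UpperHalfPlane.upperHalfPlaneSet) (d : ℝ), Literature.Probability.RandomPlanarGeometry.IsRestrictionMap A Φ → Literature.Probability.RandomPlanarGeometry.HasRestrictionDeriv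 A Φ d → Filter.Tendsto (fun δ => ((Literature.Probability.RandomPlanarGeometry.SAW.law D.carrier δ (a δ) (b δ)).map (fun γ => γ.curve)) (Literature.Probability.RandomPlanarGeometry.CurveClass.rangeSubset (closure D'.carrier))) (nhdsWithin 0 (Set.Ioi 0)) (nhds (ENNReal.ofReal (d ^ ((5 : ℝ) / 8))))

/-- item stmt-CriticalPhenomena-4982 · crux · rank 5 · SPLIT (gen 1) into SeqSlitAvoidance, LimitAvoidanceValues + glue SlitSplitGlue · direct attempts still welcome (low priority) · by planner
why it might fail: Weak limits of simple polylines need not be simple, non-retracing or boundary-avoiding: needs no-macroscopic-self-approach and no-boundary-crawling bounds at x_c under every IsEndpointApprox; only sub-ballisticity is in print.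
sources: LawlerSchrammWerner2004SAW, KennedyLawler2013, DuminilCopinHammond2013, arXiv:2310.17299, AizenmanBurchardDuke1999
[crux] (S): for every Dobrushin domain, endpoint approximation, sequence s_n → 0+ and probability
measure ν on CurveClass ℂ that is the weak limit of the pushed-forward SAW laws along s_n, ν-a.e.
curve class is simple, runs from a = D.pt 0 to b = D.pt 1, has range in closure D and meets ∂D only
at a, b (exactly the carrier clause of AvoidanceDeterminesLaw). Subsequential form of
SAWConfRestriction.SimpleOfLimit (stmt-CriticalPhenomena-0774). Foreseen split: 'range is a simple
boundary-avoiding arc' (follows from AvoidanceLimit + LSW Lemma 3.2 on filled ranges + SLE_(8/3)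
simplicity) ∧ 'no retracing' (a near-self-approach estimate for x_c-SAW). [difficulty: open-problem] -/
@[route_item "route-CriticalPhenomena-SAWLoopFugacityFlow", crux]
def SimpleSubseqLimits : Prop :=
  ∀ (D : Literature.Probability.RandomPlanarGeometry.DobrushinDomain) (a b : ℝ → Literature.Probability.LatticeModels.Site 2), Literature.Probability.RandomPlanarGeometry.SAW.IsEndpointApprox D a b → ∀ (s : ℕ → ℝ) (ν : MeasureTheory.Measure (Literature.Probability.RandomPlanarGeometry.CurveClass ℂ)), Filter.Tendsto s Filter.atTop (nhdsWithin 0 (Set.Ioi 0)) → MeasureTheory.IsProbabilityMeasure ν → (∀ f : BoundedContinuousFunction (Literature.Probability.RandomPlanarGeometry.CurveClass ℂ) ℝ, Filter.Tendsto (fun n => ∫ γ, f γ.curve ∂(Literature.Probability.RandomPlanarGeometry.SAW.law D.carrier (s n) (a (s n)) (b (s n)))) Filter.atTop (nhds (∫ x, f x ∂ν))) → ∀ᵐ γ ∂ν, γ ∈ Literature.Probability.RandomPlanarGeometry.CurveClass.simple ∧ γ.source = D.pt 0 ∧ γ.target = D.pt 1 ∧ γ.range ⊆ closure D.carrier ∧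 γ.range ∩ frontier D.carrier ⊆ {D.pt 0, D.pt 1}

-- parent: SimpleSubseqLimits · child (gen 1)
/--     item stmt-CriticalPhenomena-18169 · crux · rank 501 · open
    parent: SimpleSubseqLimits · by operator
    why it might fail: Stronger than the summit-implied residual: asks SLE(8/3)-type boundary avoidance of the conditional SAW CONTINUOUSLY along rough mesh-dependent slit graphs (folded tips = two prime ends, interior roots); Kennedy–Lawler tip effects or a slit-pinched exit could keep the far-approach probability ≥ θ.
    sources: LawlerSchrammWerner2004SAW, LawlerSchrammWerner2003Restriction, KennedyLawler2013, ChelkakSmirnov2012, stmt-CriticalPhenomena-4982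
[crux] (S₁) SEQUENTIAL SLIT AVOIDANCE — the ONE open input left in crux SimpleSubseqLimits
(stmt-CriticalPhenomena-4982) after eleven lead seats; line slit-continuous-restriction (lead c9),
whose closing
`Summit.CriticalPhenomena.SAWScalingLimit.Theorems.SimpleSubseqLimits.SlitRestriction.Line.line_slitContinuousRestriction
: SequentialSlitAvoidance → AvoidanceLimit → SimpleSubseqLimits` is LANDED (p154999); the split glue
SeqSlitAvoidance → LimitAvoidanceValues → SimpleSubseqLimits is its route-neutral core
`…SlitRestriction.Line.core_of_seqSlitAvoidance` + `Negative.simpleSubseqLimits_iff_core` (one line;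
candidate in strategist s2 evidence Split.lean `SimpleSubseqLimits_of_slitSubs'`). Statement: for
every Dobrushin domain (D; a, b), endpoint approximation, ADMISSIBLE limit past π (its range is a
simple arc from a meeting ∂D only at a; π 1 ∈ B̄(q, ρ)), guard radius R > ρ and target θ > 0 there
is a width ε > 0 such that along EVERY sequence of meshes s n → 0⁺ and lattice first-entrance
prefixes ω n : a_{s n} → t n into B̄(q, ρ) (tip inside, earlier vertices outside) whose curve
classes converge to the class of π, eventually P_δ[prefix ω n ∧ some later vertex is ε-close to the
R- -/
@[route_item "route-CriticalPhenomena-SAWLoopFugacityFlow", crux]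
def SeqSlitAvoidance : Prop :=
  ∀ (D : Literature.Probability.RandomPlanarGeometry.DobrushinDomain) (a b : ℝ → Literature.Probability.LatticeModels.Site 2), Literature.Probability.RandomPlanarGeometry.SAW.IsEndpointApprox D a b → ∀ (π : Literature.Probability.RandomPlanarGeometry.Curve ℂ) (q : ℂ) (ρ R : ℝ), 0 < ρ → ρ < R → ((π 1 ∈ Metric.closedBall q ρ) ∧ Set.range (fun u : unitInterval => π u) ⊆ closure D.carrier ∧ ∃ e : C(unitInterval, ℂ), Function.Injective e ∧ Set.range e = Set.range (fun u : unitInterval => π u) ∧ e 0 = D.pt 0 ∧ ∀ u : unitInterval, e u ∈ frontier D.carrier → u = 0) → ∀ θ : ℝ, 0 < θ → ∃ ε : ℝ, 0 < ε ∧ ∀ (s : ℕ → ℝ) (t : ℕ → Literature.Probability.LatticeModels.Site 2) (ω : ∀ n : ℕ, Literature.Probability.RandomPlanarGeometry.SAW.DomainSAW D.carrier (s n) (a (s n)) (t n)), Filter.Tendsto s Filter.atTop (nhdsWithin 0 (Set.Ioi 0)) → (∀ n : ℕ, Literature.Probability.LatticeModels.meshPoint (s n) (t n) ∈ Metric.closedBall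 q ρ) → (∀ n : ℕ, ∀ x ∈ (ω n).walk.support.dropLast, Literature.Probability.LatticeModels.meshPoint (s n) x ∉ Metric.closedBall q ρ) → Filter.Tendsto (fun n => (ω n).curve) Filter.atTop (nhds (Literature.Probability.RandomPlanarGeometry.CurveClass.mk π)) → ∀ᶠ n in Filter.atTop, Literature.Probability.RandomPlanarGeometry.SAW.law D.carrier (s n) (a (s n)) (b (s n)) {γ : Literature.Probability.RandomPlanarGeometry.SAW.DomainSAW D.carrier (s n) (a (s n)) (b (s n)) | γ.walk.support.take ((ω n).length + 1) = (ω n).walk.support ∧ ∃ j : ℕ, (ω n).length ≤ j ∧ j ≤ γ.length ∧ ∃ z ∈ ((fun u : unitInterval => π u) '' {u : unitInterval | ∀ u' : unitInterval, u' ≤ u → R < dist (π u') q}), dist (Literature.Probability.LatticeModels.meshPoint (s n) (γ.walk.getVert j)) z < ε} ≤ ENNReal.ofReal θ * Literature.Probability.RandomPlanarGeometry.SAW.law D.carrier (s n) (a (s n)) (b (s n)) {γ : Literature.Probability.RandomPlanarGeometry.SAW.DomainSAW D.carrier (s n) (a (s n)) (b (s n)) | γ.walk.support.take ((ω n).length +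 1) = (ω n).walk.support}

-- parent: SimpleSubseqLimits · child (gen 1)
/--     item stmt-CriticalPhenomena-18170 · support · rank 502 · open
    parent: SimpleSubseqLimits · by operator
    sources: LawlerSchrammWerner2003Restriction, LawlerSchrammWerner2004SAW, stmt-CriticalPhenomena-10649
[support] LIMIT AVOIDANCE VALUES (the SHAPE input of the split; route-neutral): every subsequential
weak limit ν of the pushed-forward critical SAW laws along an endpoint approximation has the
hull-avoidance values of SOME chordal SLE(8/3) law μ of (D; a, b): ν(range ⊆ cl D') = μ(range ⊆ cl
D') for every hull subdomain D' (same marked points, agreeing with D near a, b). Verbatim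
`…Theorems.SimpleSubseqLimits.PastShadowing.Main.AvoidanceValues` with WeakLimitAlong inlined
(Iff.rfl: strategist s2 evidence Split.lean `avoidanceValuesText_iff`). INSIDE route
SAWLoopFugacityFlow it is FREE GIVEN THE A-SIDE: `RouteResidual.avoidanceValues_of_avoidanceLimit :
AvoidanceLimit → AvoidanceValues` (landed, p138437 family; = AvoidanceLimit + AvoidancePassage
p-proved + SLEAvoidanceValue proved) — so it closes by one line the moment
stmt-CriticalPhenomena-10649 closes and must NOT be attacked directly (do not staff; release
blocked-on stmt-10649 if served). It is a separate child only because a split child cannot be the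
route's existing decl AvoidanceLimit; for the sibling routes SAWSteinDefect / SAWTensorRG /
SAWFrontierHomotopy (which share the parent crux) it is exactly the interface their ow -/
@[route_item "route-CriticalPhenomena-SAWLoopFugacityFlow", crux]
def LimitAvoidanceValues : Prop :=
  ∀ (D : Literature.Probability.RandomPlanarGeometry.DobrushinDomain) (a b : ℝ → Literature.Probability.LatticeModels.Site 2), Literature.Probability.RandomPlanarGeometry.SAW.IsEndpointApprox D a b → ∀ (s : ℕ → ℝ) (ν : MeasureTheory.Measure (Literature.Probability.RandomPlanarGeometry.CurveClass ℂ)), Filter.Tendsto s Filter.atTop (nhdsWithin 0 (Set.Ioi 0)) → MeasureTheory.IsProbabilityMeasure ν → (∀ f : BoundedContinuousFunction (Literature.Probability.RandomPlanarGeometry.CurveClass ℂ) ℝ, Filter.Tendsto (fun n => ∫ γ, f γ.curve ∂(Literature.Probability.RandomPlanarGeometry.SAW.law D.carrier (s n) (a (s n)) (b (s n)))) Filter.atTop (nhds (∫ x, f x ∂ν))) → ∃ μ : MeasureTheory.Measure (Literature.Probability.RandomPlanarGeometry.CurveClass ℂ), Literature.Probability.RandomPlanarGeometry.IsSLELaw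 ((8 : NNReal) / 3) D μ ∧ ∀ D' : Literature.Probability.RandomPlanarGeometry.DobrushinDomain, D'.carrier ⊆ D.carrier → D'.pt 0 = D.pt 0 → D'.pt 1 = D.pt 1 → (∃ ε : ℝ, 0 < ε ∧ D'.carrier ∩ Metric.ball (D.pt 0) ε = D.carrier ∩ Metric.ball (D.pt 0) ε ∧ D'.carrier ∩ Metric.ball (D.pt 1) ε = D.carrier ∩ Metric.ball (D.pt 1) ε) → ν (Literature.Probability.RandomPlanarGeometry.CurveClass.rangeSubset (closure D'.carrier)) = μ (Literature.Probability.RandomPlanarGeometry.CurveClass.rangeSubset (closure D'.carrier))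

-- parent: SimpleSubseqLimits · glue (gen 1)
/--     item stmt-CriticalPhenomena-18171 · support · rank 503 · closed · proved by Summit.CriticalPhenomena.SAWScalingLimit.Theorems.SimpleSubseqLimits.SlitSplit.slitSplitGlue_proof @ 64578adc116f (planner)
    parent: SimpleSubseqLimits · GLUE: children ⟹ parent · by operator
SeqSlitAvoidance → LimitAvoidanceValues → SimpleSubseqLimits — PROVABLE NOW in one line from LANDED
theorems: fun h hV => Negative.simpleSubseqLimits_iff_core.2
(SlitRestriction.Line.core_of_seqSlitAvoidance h hV) (p154999
Theorems/SAWLoopFugacityFlowSimpleSubseqLimitsSlitLine.lean; the route decls unfold definitionally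
to Transfer.SequentialSlitAvoidance / PastShadowing.Main.AvoidanceValues, Iff.rfl); kernel-checked
candidate = item evidence SAWLoopFugacityFlowSimpleSubseqLimitsSplit.lean, theorem
SimpleSubseqLimits_of_slitSubs' (strategist s2; rc0, axioms std) -/
@[route_item "route-CriticalPhenomena-SAWLoopFugacityFlow"]
def SlitSplitGlue : Prop :=
  SeqSlitAvoidance → LimitAvoidanceValues → SimpleSubseqLimits

-- `SlitSplitGlue` holds: proved by `Summit.CriticalPhenomena.SAWScalingLimit.Theorems.SimpleSubseqLimits.SlitSplit.slitSplitGlue_proof` @ 64578adc116f (its module imports this route file, so no `_holds` link can be stated here).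

-- item stmt-CriticalPhenomena-5063 · support · rank 3 · open · by planner — informal only, no Lean statement yet:
--   [crux] FugacityAnalyticity (card M2, the engine; INFORMAL until the definition DiluteLoopModel
--   lands): for the dilute non-crossing loop model L_{n,w,x} on Ω_δ = discreteDomainGraph D δ (edge
--   subgraphs with sources a_δ, b_δ, degrees ≤ 4, non-crossing pairings at degree-4 vertices, weight
--   x^|η| w^{N₄} n^{#loops}) taken along the diagonal path w = n/2 at the critical fugacity x = x_c(n)
--   := x_c(n, n/2), and for every Dobrushin D, hull subdomain D' (same marked points, agreeing with D
--   near a, b) and endpoint approximation: (i) n ↦ x_c(n) extends holomorphically from [0, 1] to a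
--   complex neighbourhoo

-- item stmt-CriticalPhenomena-5080 · support · rank 4 · open · by planner — informal only, no Lean statement yet:
--   [crux] IsingWindow (card M1, perturbative window at the free fermion; INFORMAL until DiluteLoopModel
--   lands): there is ε₀ > 0 such that for every n ∈ (1 − ε₀, 1], every Dobrushin D, hull subdomain D',
--   endpoint approximation and restriction data (φ, Φ, d = Φ'_A(0)) as in AvoidanceLimit, the two-leg
--   boundary ratio of the dilute non-crossing loop model on Ω_δ ⊆ δℤ² along w = n/2, x = x_c(n)
--   satisfies lim_{δ→0+} R_δ(n; D, D') = d^{b(n)} with b(n) = (6 − κ(n))/(2κ(n)), n = −2cos(4π/κ(n)),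
--   κ(1 − ε) = 3 − (9/(4π√3)) ε + O(ε²); the case n = 1 is the typed item IsingBoundaryRatio (b(1) =
--   1/2). Intended

-- earlier IsingBoundaryRatio (stmt-CriticalPhenomena-4983, replaced 2026-08-15T16:20:18Z -> stmt-CriticalPhenomena-10650): retired by None — ∀ (D D' : Literature.Probability.RandomPlanarGeometry.DobrushinDomain) (a b : ℝ → Literature.Probability.LatticeModels.Site 2), Literature.Probability.RandomPlanarGeometry.SAW.IsEndpointApprox D a b → Literature.Probability.RandomPlanarGeometry.SAW.IsEndpointAp
/-- item stmt-CriticalPhenomena-10650 · aside · rank 6 · open · by planner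
why it might fail: Printed free-b.c. results (Hongler–Kytölä 2013, BDH 2016, CGG 2024 half-plane) do not state this nested-domain RATIO for general Jordan D with endpoints possibly at mesoscopic depth; the local endpoint factors must cancel between D and D'.
sources: doi:10.1090/s0894-0347-2013-00774-2, doi:10.1214/15-aihp698, arXiv:2408.12923, ChelkakHonglerIzyurov2015, CDHKSCRAS2014, MccoyWu1973
[crux] the n = 1 ANCHOR, typed (rev 2, PlanarIsing-free form: volume = the mesh-domain finset
written inline (= PlanarIsing.meshDomainFinset by rfl), β = log(1+√2)/2 inline (= criticalBetaTwo by
rfl), the LocallyFinite structure of Ω_δ quantified as a family lf — a subsingleton, instantiate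
with PlanarIsing.instLocallyFiniteDiscreteDomainGraph — and the hull inline as in AvoidanceLimit;
PROVED equivalent to the rev-1 item stmt-CriticalPhenomena-4983): for D, D', (a_δ, b_δ) an endpoint
approximation in BOTH Ω_δ and Ω'_δ, φ, Φ, d as in AvoidanceLimit, the ratio of
free-boundary-condition critical Ising boundary two-point functions ⟨σ_(a_δ) σ_(b_δ)⟩^free_(Ω'_δ) /
⟨σ_(a_δ) σ_(b_δ)⟩^free_(Ω_δ) (Literature.Probability.LatticeModels.isingTwoPoint on
discreteDomainGraph with volume the mesh domain, β = β_c(2) = ½ log(1+√2), h = 0,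
BoundaryCondition.free) converges to d^(1/2) as δ → 0+. By the high-temperature expansion ⟨σ_a
σ_b⟩^free = Z_1(Ω_δ; a,b)/Z_1(Ω_δ) (tanh β_c = √2 − 1), so this IS lim R_δ(1; D, D') = Φ'_A(0)^b(1),
b(1) = 1/2: the boundary spin is a weight-½ boundary primary in chordal normalisation (other point
at ∞ under Φ_A(z) ∼ z). By Kramers–Wannier it is also the ratio of dua -/
@[route_item "route-CriticalPhenomena-SAWLoopFugacityFlow", crux]
def IsingBoundaryRatio : Prop :=
  ∀ (lf : ∀ (Ω : Set ℂ) (δ : ℝ), (Literature.Probability.LatticeModels.discreteDomainGraph Ω δ).LocallyFinite) (D D' : Literature.Probability.RandomPlanarGeometry.DobrushinDomain) (a b : ℝ → Literature.Probability.LatticeModels.Site 2), Literature.Probability.RandomPlanarGeometry.SAW.IsEndpointApprox D a b → Literature.Probability.RandomPlanarGeometry.SAW.IsEndpointApprox D' a b → D'.carrier ⊆ D.carrier → D'.pt 0 = D.pt 0 → D'.pt 1 = D.pt 1 → (∃ ε : ℝ, 0 < ε ∧ D'.carrier ∩ Metric.ball (D.pt 0) ε = D.carrier ∩ Metric.ball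 (D.pt 0) ε ∧ D'.carrier ∩ Metric.ball (D.pt 1) ε = D.carrier ∩ Metric.ball (D.pt 1) ε) → ∀ (φ : Literature.Probability.RandomPlanarGeometry.ConformalEquiv UpperHalfPlane.upperHalfPlaneSet D.carrier), D.IsChordalUniformizing φ → ∀ (A : Set ℂ), A = closure (UpperHalfPlane.upperHalfPlaneSet \ {z | z ∈ UpperHalfPlane.upperHalfPlaneSet ∧ φ z ∈ D'.carrier}) → ∀ (Φ : Literature.Probability.RandomPlanarGeometry.ConformalEquiv (UpperHalfPlane.upperHalfPlaneSet \ A) UpperHalfPlane.upperHalfPlaneSet) (d : ℝ), Literature.Probability.RandomPlanarGeometry.IsRestrictionMap A Φ → Literature.Probability.RandomPlanarGeometry.HasRestrictionDeriv A Φ d → Filter.Tendsto (fun δ => @Literature.Probability.LatticeModels.isingTwoPoint _ (Literature.Probability.LatticeModels.discreteDomainGraph D'.carrier δ) _ (lf D'.carrier δ) (if h : Bornology.IsBounded D'.carrier ∧ 0 < δ then (Literature.Probability.LatticeModels.meshDomain_finite h.1 h.2).toFinset else ∅) (Real.log (1 + Real.sqrt 2) / 2) 0 Literature.Probability.LatticeModels.BoundaryCondition.free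 (a δ) (b δ) / @Literature.Probability.LatticeModels.isingTwoPoint _ (Literature.Probability.LatticeModels.discreteDomainGraph D.carrier δ) _ (lf D.carrier δ) (if h : Bornology.IsBounded D.carrier ∧ 0 < δ then (Literature.Probability.LatticeModels.meshDomain_finite h.1 h.2).toFinset else ∅) (Real.log (1 + Real.sqrt 2) / 2) 0 Literature.Probability.LatticeModels.BoundaryCondition.free (a δ) (b δ)) (nhdsWithin 0 (Set.Ioi 0)) (nhds (d ^ ((1 : ℝ) / 2)))

/-- item stmt-CriticalPhenomena-0783 · support · rank 9 · open · by planner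
sources: LawlerSchrammWerner2004SAW, LawlerSchrammWerner2003Restriction
[crux] r3: identification of subsequential limits — for every Dobrushin domain D, endpoint
approximation (a_δ,b_δ), sequence s_n → 0+ and probability measure μ on CurveClass ℂ, if ∫ f∘curve
d(Literature.Probability.RandomPlanarGeometry.SAW.law D (s n) …) → ∫ f dμ for all bounded continuous
f then μ is the chordal SLE_{8/3} law in D (Literature.Probability.RandomPlanarGeometry.IsSLELaw
(8/3) D μ). Obtained from r2 (observable limit) by the martingale principle (LSW03
arXiv:math/0209343 Prop. 5.2: κ = 8/3 is singled out by the 5/8-observable), or from restriction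
(sibling route). -/
@[route_item "route-CriticalPhenomena-SAWLoopFugacityFlow", crux]
def SubseqIdentification : Prop :=
  ∀ (D : Literature.Probability.RandomPlanarGeometry.DobrushinDomain) (a b : ℝ → Literature.Probability.LatticeModels.Site 2), Literature.Probability.RandomPlanarGeometry.SAW.IsEndpointApprox D a b → ∀ (s : ℕ → ℝ) (μ : MeasureTheory.Measure (Literature.Probability.RandomPlanarGeometry.CurveClass ℂ)), Filter.Tendsto s Filter.atTop (nhdsWithin 0 (Set.Ioi 0)) → MeasureTheory.IsProbabilityMeasure μ → (∀ f : BoundedContinuousFunction (Literature.Probability.RandomPlanarGeometry.CurveClass ℂ) ℝ, Filter.Tendsto (fun n => ∫ γ, f γ.curve ∂(Literature.Probability.RandomPlanarGeometry.SAW.law D.carrier (s n) (a (s n)) (b (s n)))) Filter.atTop (nhds (∫ x, f x ∂μ))) → Literature.Probability.RandomPlanarGeometry.IsSLELaw ((8 : NNReal) / 3) D μ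

-- earlier SLEAvoidanceValue (stmt-CriticalPhenomena-4986, replaced 2026-08-15T16:20:18Z -> stmt-CriticalPhenomena-10651): proved by Summit.CriticalPhenomena.SAWScalingLimit.Theorems.SLEAvoidanceValue_pullbackHull_proof @ 20a055b94c44 — ∀ (D D' : Literature.Probability.RandomPlanarGeometry.DobrushinDomain) (μ : MeasureTheory.Measure (Literature.Probability.RandomPlanarGeometry.CurveClass ℂ)), Literat
/-- item stmt-CriticalPhenomena-10651 · support · rank 9 · closed · proved by Summit.CriticalPhenomena.SAWScalingLimit.Theorems.SLEAvoidanceValue_proof (prover) · by planner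
sources: LawlerSchrammWerner2003Restriction
[support] LSW03 Thm 6.1 transposed to hull subdomains in the ε-ball form used here (rev 2: hull
inline, A = closure (ℍ ∖ φ⁻¹(D')) quantified as `∀ A, A = … →`; = φ.pullbackHull D' by rfl; the
rev-1 item stmt-CriticalPhenomena-4986 carries a grounder's candidate proof
SLEAvoidanceValueCandidate.lean, which proves this form after `intro … A hA; subst hA`): for μ the
chordal SLE_(8/3) law of D, D' ⊆ D agreeing with D near a, b, φ chordal uniformizing, Φ the
restriction map of A with derivative d, μ(range ⊆ closure D') = ofReal(d^(5/8)) (in tree: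
sle_restriction_eightThirds_holds + HullRestrictionNull '{Γ ⊆ cl D'} and {γ ∩ A = ∅} agree a.s.' +
IsStarHull.pullbackHull). Expected to close from the tree. [difficulty: provable-now] -/
@[route_item "route-CriticalPhenomena-SAWLoopFugacityFlow", crux]
def SLEAvoidanceValue : Prop :=
  ∀ (D D' : Literature.Probability.RandomPlanarGeometry.DobrushinDomain) (μ : MeasureTheory.Measure (Literature.Probability.RandomPlanarGeometry.CurveClass ℂ)), Literature.Probability.RandomPlanarGeometry.IsSLELaw ((8 : NNReal) / 3) D μ → D'.carrier ⊆ D.carrier → D'.pt 0 = D.pt 0 → D'.pt 1 = D.pt 1 → (∃ ε : ℝ, 0 < ε ∧ D'.carrier ∩ Metric.ball (D.pt 0) ε = D.carrier ∩ Metric.ball (D.pt 0) ε ∧ D'.carrier ∩ Metric.ball (D.pt 1) ε = D.carrier ∩ Metric.ball (D.pt 1) ε) → ∀ (φ : Literature.Probability.RandomPlanarGeometry.ConformalEquiv UpperHalfPlane.upperHalfPlaneSet D.carrier), D.IsChordalUniformizing φ → ∀ (A : Set ℂ), A = closure (UpperHalfPlane.upperHalfPlaneSet \ {z | z ∈ UpperHalfPlane.upperHalfPlaneSet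 ∧ φ z ∈ D'.carrier}) → ∀ (Φ : Literature.Probability.RandomPlanarGeometry.ConformalEquiv (UpperHalfPlane.upperHalfPlaneSet \ A) UpperHalfPlane.upperHalfPlaneSet) (d : ℝ), Literature.Probability.RandomPlanarGeometry.IsRestrictionMap A Φ → Literature.Probability.RandomPlanarGeometry.HasRestrictionDeriv A Φ d → μ (Literature.Probability.RandomPlanarGeometry.CurveClass.rangeSubset (closure D'.carrier)) = ENNReal.ofReal (d ^ ((5 : ℝ) / 8))

-- `SLEAvoidanceValue` holds: proved by `Summit.CriticalPhenomena.SAWScalingLimit.Theorems.SLEAvoidanceValue_proof` (its module imports this route file, so no `_holds` link can be stated here).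

/-- item stmt-CriticalPhenomena-1372 · support · rank 9 · open · by planner
sources: KemppainenSmirnov2017, AizenmanBurchardDuke1999, DuminilCopinHammond2013
[support] eventual tightness of the pushed-forward critical SAW laws: for every Dobrushin domain and
endpoint approximation there is δ₀ > 0 such that {(law D δ a_δ b_δ).map curve : δ ∈ (0, δ₀]} is a
tight set of measures on CurveClass ℂ — the repaired (∃ δ₀) form of the refuted all-δ statement
stmt-CriticalPhenomena-0772 suggested by its refutation; child-designate of LimitExists, shared need
of every SAW route. Intended tools: Aizenman–Burchard / Kemppainen–Smirnov Condition G2 (an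
annulus-crossing bound at x_c not in print). Sources: KemppainenSmirnov2017 Thm 1.5,
AizenmanBurchardDuke1999, DuminilCopinHammond2013. -/
@[route_item "route-CriticalPhenomena-SAWLoopFugacityFlow", crux]
def EventualTight : Prop :=
  ∀ (D : Literature.Probability.RandomPlanarGeometry.DobrushinDomain) (a b : ℝ → Literature.Probability.LatticeModels.Site 2), Literature.Probability.RandomPlanarGeometry.SAW.IsEndpointApprox D a b → ∃ δ₀ : ℝ, 0 < δ₀ ∧ MeasureTheory.IsTightMeasureSet ((fun δ => (Literature.Probability.RandomPlanarGeometry.SAW.law D.carrier δ (a δ) (b δ)).map (fun γ => γ.curve)) '' Set.Ioc 0 δ₀)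

/-- item stmt-CriticalPhenomena-1373 · support · rank 9 · closed · proved by Summit.CriticalPhenomena.SAWScalingLimit.Theorems.AvoidanceDeterminesLaw.AvoidanceDeterminesLaw_proof (prover) · by planner
sources: LawlerSchrammWerner2003Restriction, AizenmanBurchardDuke1999
[support] avoidance determines the law: two probability measures on CurveClass ℂ carried by SIMPLE
chords of the Dobrushin domain D from a to b meeting ∂D only at a, b, which give the same mass to
{range ⊆ closure D'} for every Dobrushin D' ⊆ D with the same marked points and agreeing with D near
a and b (the form delivered by AvoidanceCocycleLimit), are equal (π-system of filled hull
complements generating the Borel sets of simple boundary-avoiding chords: a simple chord is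
determined by its range; Lusin–Souslin for γ ↦ range). Planar-topology/measure-theory analogue of
LSW03 §3 ('the law of K is determined by P[K ∩ A = ∅]'); used for uniqueness of subsequential SAW
limits and for uniqueness of the restriction extension to slit domains. Sources:
LawlerSchrammWerner2003Restriction §3, AizenmanBurchard1999 §2.1. -/
@[route_item "route-CriticalPhenomena-SAWLoopFugacityFlow", crux]
def AvoidanceDeterminesLaw : Prop :=
  ∀ (D : Literature.Probability.RandomPlanarGeometry.DobrushinDomain) (μ ν : MeasureTheory.Measure (Literature.Probability.RandomPlanarGeometry.CurveClass ℂ)), MeasureTheory.IsProbabilityMeasure μ → MeasureTheory.IsProbabilityMeasure ν → (∀ᵐ γ ∂μ, γ ∈ Literature.Probability.RandomPlanarGeometry.CurveClass.simple ∧ γ.source = D.pt 0 ∧ γ.target = D.pt 1 ∧ γ.range ⊆ closure D.carrier ∧ γ.range ∩ frontier D.carrier ⊆ {D.pt 0, D.pt 1}) → (∀ᵐ γ ∂ν, γ ∈ Literature.Probability.RandomPlanarGeometry.CurveClass.simple ∧ γ.source = D.pt 0 ∧ γ.target = D.pt 1 ∧ γ.range ⊆ closure D.carrier ∧ γ.range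 ∩ frontier D.carrier ⊆ {D.pt 0, D.pt 1}) → (∀ D' : Literature.Probability.RandomPlanarGeometry.DobrushinDomain, D'.carrier ⊆ D.carrier → D'.pt 0 = D.pt 0 → D'.pt 1 = D.pt 1 → (∃ ε : ℝ, 0 < ε ∧ D'.carrier ∩ Metric.ball (D.pt 0) ε = D.carrier ∩ Metric.ball (D.pt 0) ε ∧ D'.carrier ∩ Metric.ball (D.pt 1) ε = D.carrier ∩ Metric.ball (D.pt 1) ε) → μ (Literature.Probability.RandomPlanarGeometry.CurveClass.rangeSubset (closure D'.carrier)) = ν (Literature.Probability.RandomPlanarGeometry.CurveClass.rangeSubset (closure D'.carrier))) → μ = ν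

-- `AvoidanceDeterminesLaw` holds: proved by `Summit.CriticalPhenomena.SAWScalingLimit.Theorems.AvoidanceDeterminesLaw.AvoidanceDeterminesLaw_proof` (its module imports this route file, so no `_holds` link can be stated here).

/-- item stmt-CriticalPhenomena-18279 · support · rank 9 · closed · proved by Summit.CriticalPhenomena.SAWScalingLimit.Theorems.SimpleSubseqLimits.SlitSplit.slitSplitDischarge_proof @ b15e8f983b18 (planner) · by planner
[support] glue (route-repair rrepair-d45a51c8, unused-crux): the gen-1 split of SimpleSubseqLimits
is DISCHARGED BY THE A-SIDE inside this route — given the split glue SlitSplitGlue (stmt-18171), the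
crux child SeqSlitAvoidance (stmt-18169) and the route's A-side AvoidanceLimit (stmt-10649) yield
the parent SimpleSubseqLimits, because the shape child LimitAvoidanceValues (stmt-18170) is free
given AvoidanceLimit. PROVABLE NOW, two kernel-checked one-liners in the planner's Scratch_item.lean
(rc0, axioms propext/Classical.choice/Quot.sound): `fun hG hSeq hA => hG hSeq
(Theorems.SimpleSubseqLimits.FarPast.RouteResidual.avoidanceValues_of_avoidanceLimit hA)`
(Theorems/SAWLoopFugacityFlowSimpleSubseqLimitsRouteResidual.lean:77) or `fun _ hSeq hA =>
Theorems.SimpleSubseqLimits.SlitRestriction.Line.line_slitContinuousRestriction hSeq hA` (p154999,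
Theorems/SAWLoopFugacityFlowSimpleSubseqLimitsSlitLine.lean:102). ROLE: this is the TOP-LEVEL link
that puts the split (SeqSlitAvoidance, LimitAvoidanceValues, SlitSplitGlue) into the cone of the
deciding theorem `closes`, which takes it as a hypothesis next to the parent SimpleSubseqLimits; the
children themselves cannot be hypotheses of `clos -/
@[route_item "route-CriticalPhenomena-SAWLoopFugacityFlow", crux]
def SlitSplitDischarge : Prop :=
  SlitSplitGlue → SeqSlitAvoidance → AvoidanceLimit → SimpleSubseqLimits

-- `SlitSplitDischarge` holds: proved by `Summit.CriticalPhenomena.SAWScalingLimit.Theorems.SimpleSubseqLimits.SlitSplit.slitSplitDischarge_proof` @ b15e8f983b18 (its module imports this route file, so no `_holds` link can be stated here).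

/-- item stmt-CriticalPhenomena-4984 · support · rank 9 · closed · proved by Summit.CriticalPhenomena.SAWScalingLimit.Theorems.avoidancePassage_proof @ e48fe0a81c9f (prover) · by planner
sources: LawlerSchrammWerner2003Restriction, AizenmanBurchardDuke1999
[support] portmanteau sandwich: if ν is the weak limit of the pushed-forward SAW laws along s_n →
0+, μ is the chordal SLE_(8/3) law of D, and along s_n the SAW avoidance probabilities of EVERY hull
subdomain D'' converge to μ(range ⊆ closure D''), then ν(range ⊆ closure D') = μ(range ⊆ closure D')
for every hull subdomain D'. '≥': the event is closed (CurveClass.isClosed_rangeSubset). '≤':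
approximate D' from outside by hull super-domains D'_k ⊇ (neighbourhood of cl D') ∩ D with cl D'_k ↓
cl D' (pull back to ℍ: shrink the *-hull A inside its inner parallel sets and re-attach to ℝ), use
open events rangeSubset(U_k) (isOpen_rangeSubset), lattice curves live in cl D, and continuity from
above of μ (or kernel continuity of Φ'_A(0), LSWConverges.tendsto_restrictionDeriv). Planar topology
+ measure theory; provable now. [difficulty: M] -/
@[route_item "route-CriticalPhenomena-SAWLoopFugacityFlow", crux]
def AvoidancePassage : Prop :=
  ∀ (D : Literature.Probability.RandomPlanarGeometry.DobrushinDomain) (a b : ℝ → Literature.Probability.LatticeModels.Site 2), Literature.Probability.RandomPlanarGeometry.SAW.IsEndpointApprox D a b → ∀ (s : ℕ → ℝ) (ν μ : MeasureTheory.Measure (Literature.Probability.RandomPlanarGeometry.CurveClass ℂ)), Filter.Tendsto s Filter.atTop (nhdsWithin 0 (Set.Ioi 0)) → MeasureTheory.IsProbabilityMeasure ν → (∀ f : BoundedContinuousFunction (Literature.Probability.RandomPlanarGeometry.CurveClass ℂ) ℝ, Filter.Tendsto (fun n => ∫ γ, f γ.curve ∂(Literature.Probability.RandomPlanarGeometry.SAW.law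 D.carrier (s n) (a (s n)) (b (s n)))) Filter.atTop (nhds (∫ x, f x ∂ν))) → Literature.Probability.RandomPlanarGeometry.IsSLELaw ((8 : NNReal) / 3) D μ → (∀ D' : Literature.Probability.RandomPlanarGeometry.DobrushinDomain, D'.carrier ⊆ D.carrier → D'.pt 0 = D.pt 0 → D'.pt 1 = D.pt 1 → (∃ ε : ℝ, 0 < ε ∧ D'.carrier ∩ Metric.ball (D.pt 0) ε = D.carrier ∩ Metric.ball (D.pt 0) ε ∧ D'.carrier ∩ Metric.ball (D.pt 1) ε = D.carrier ∩ Metric.ball (D.pt 1) ε) → Filter.Tendsto (fun n => ((Literature.Probability.RandomPlanarGeometry.SAW.law D.carrier (s n) (a (s n)) (b (s n))).map (fun γ => γ.curve)) (Literature.Probability.RandomPlanarGeometry.CurveClass.rangeSubset (closure D'.carrier))) Filter.atTop (nhds (μ (Literature.Probability.RandomPlanarGeometry.CurveClass.rangeSubset (closure D'.carrier))))) → ∀ D' : Literature.Probability.RandomPlanarGeometry.DobrushinDomain, D'.carrier ⊆ D.carrier → D'.pt 0 = D.pt 0 → D'.pt 1 = D.pt 1 → (∃ ε : ℝ, 0 <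 ε ∧ D'.carrier ∩ Metric.ball (D.pt 0) ε = D.carrier ∩ Metric.ball (D.pt 0) ε ∧ D'.carrier ∩ Metric.ball (D.pt 1) ε = D.carrier ∩ Metric.ball (D.pt 1) ε) → ν (Literature.Probability.RandomPlanarGeometry.CurveClass.rangeSubset (closure D'.carrier)) = μ (Literature.Probability.RandomPlanarGeometry.CurveClass.rangeSubset (closure D'.carrier))

-- `AvoidancePassage` holds: proved by `Summit.CriticalPhenomena.SAWScalingLimit.Theorems.avoidancePassage_proof` @ e48fe0a81c9f (its module imports this route file, so no `_holds` link can be stated here).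

/-- item stmt-CriticalPhenomena-4985 · support · rank 9 · closed · proved by Summit.CriticalPhenomena.SAWScalingLimit.Theorems.SLECarrier_proof @ 502abaff2cf7 (prover) · by planner
sources: RohdeSchramm2005, LawlerSchrammWerner2003Restriction, Lawler2005
[support] the chordal SLE_(8/3) law of a Dobrushin domain is a probability measure carried by simple
curve classes from a to b with range in closure D meeting ∂D only at a, b (Rohde–Schramm simplicity
for κ ≤ 4, transience, boundary avoidance; in tree: IsSLELaw.isProbabilityMeasure,
IsSLELaw.ae_simple, IsSLELaw.ae_endpoints, chordalCarrier lemmas, behind the named Rohde–Schramm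
facts). Expected to close from the tree. [difficulty: provable-now] -/
@[route_item "route-CriticalPhenomena-SAWLoopFugacityFlow", crux]
def SLECarrier : Prop :=
  ∀ (D : Literature.Probability.RandomPlanarGeometry.DobrushinDomain) (μ : MeasureTheory.Measure (Literature.Probability.RandomPlanarGeometry.CurveClass ℂ)), Literature.Probability.RandomPlanarGeometry.IsSLELaw ((8 : NNReal) / 3) D μ → MeasureTheory.IsProbabilityMeasure μ ∧ ∀ᵐ γ ∂μ, γ ∈ Literature.Probability.RandomPlanarGeometry.CurveClass.simple ∧ γ.source = D.pt 0 ∧ γ.target = D.pt 1 ∧ γ.range ⊆ closure D.carrier ∧ γ.range ∩ frontier D.carrier ⊆ {D.pt 0, D.pt 1}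

-- `SLECarrier` holds: proved by `Summit.CriticalPhenomena.SAWScalingLimit.Theorems.SLECarrier_proof` @ 502abaff2cf7 (its module imports this route file, so no `_holds` link can be stated here).

-- earlier Assembly (stmt-CriticalPhenomena-4538, replaced 2026-08-15T16:31:33Z -> stmt-CriticalPhenomena-10724): proved by Summit.CriticalPhenomena.SAWScalingLimit.Theorems.frontierHomotopy_tightIdentificationGlue_proof @ cf29ad9b5131 — EventualTight → SubseqIdentification → SAWScalingLimit
-- earlier Assembly (stmt-CriticalPhenomena-4988, replaced 2026-08-15T16:20:18Z -> stmt-CriticalPhenomena-4538): retired by None — Literature.Probability.RandomPlanarGeometry.CurveClass.polishSpace (E := ℂ) → Literature.Probability.RandomPlanarGeometry.IsSLECurve.map_eq → Literature.Probability.RandomPlanarGeometry.exists_isSLECurve → Literature.Probability.RandomPlanarGeometry.MarkedDomain.exists_is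
/-- item stmt-CriticalPhenomena-10724 · assembly · rank 1 · closed · proved by Summit.CriticalPhenomena.SAWScalingLimit.Theorems.Assembly_proof (prover) · by planner
sources: LawlerSchrammWerner2003Restriction, LawlerSchrammWerner2004SAW, KemppainenSmirnov2017
[assembly] SLECarrier → SLEAvoidanceValue → AvoidanceLimit → EventualTight → SimpleSubseqLimits →
AvoidancePassage → AvoidanceDeterminesLaw → SAWScalingLimit — the restriction tail shared verbatim
with SAWLoopFugacityFlow (its Assembly stmt-CriticalPhenomena-4988 minus the four Literature
antecedents); in the deciding theorem `closes` the antecedent AvoidanceLimit is produced by the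
layer-1 glue DefectToAvoidance from DefectIdentity, ExcursionInitialValue, BalanceChannel,
CubicRemainder, so every crux of the thesis is load-bearing. The four Literature antecedents of rev
0 (CurveClass.polishSpace, IsSLECurve.map_eq, exists_isSLECurve,
MarkedDomain.exists_isChordalUniformizing) are removed from the STATEMENT because the tree PROVES
what the argument consumes: CurveClass.polishSpace_holds (CurveSpace), IsSLECurve.map_eq_holds
(SLEUniquenessInLaw), exists_isSLECurve_eightThirds (SLEExistenceNeEightHolds — the all-κ fact
exists_isSLECurve is equivalent to the open SLE₈ trace theorem and is NOT needed at κ = 8/3),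
MarkedDomain.exists_isChordalUniformizing_holds (CaratheodoryHalfPlaneProofs); the ∀(φ, Φ,
d)-quantified items instantiate through IsStarHull.pullbackHull with JordanDomain.isS -/
@[route_item "route-CriticalPhenomena-SAWLoopFugacityFlow", crux]
def Assembly : Prop :=
  SLECarrier → SLEAvoidanceValue → AvoidanceLimit → EventualTight → SimpleSubseqLimits → AvoidancePassage → AvoidanceDeterminesLaw → SAWScalingLimit

-- `Assembly` holds: proved by `Summit.CriticalPhenomena.SAWScalingLimit.Theorems.Assembly_proof` (its module imports this route file, so no `_holds` link can be stated here).

-- records of items no longer active in this route (dropped / restated):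
-- earlier AvoidanceToIdentification (stmt-CriticalPhenomena-4987, replaced 2026-08-15T16:20:18Z -> stmt-CriticalPhenomena-10652): retired by None — Literature.Probability.RandomPlanarGeometry.MarkedDomain.exists_isChordalUniformizing → Literature.Probability.RandomPlanarGeometry.exists_isSLECurve → SLECarrier → SLEAvoidanceValue → AvoidanceLimit → SimpleSubseqLimits → AvoidancePassage → AvoidanceDet

/-! D-0027 §2.1 — DECIDING THEOREM (planner-authored via `route open/edit --closes-file`; by planner-rrepair-CriticalPhenomena-SAWLoopFugac-d45a51c8-0 2026-08-17T14:50:24Z):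
its hypotheses are this route's items and its conclusion the sub-problem Statement (glue_lint), and it elaborates with this file. -/

@[closes "route-CriticalPhenomena-SAWLoopFugacityFlow"] theorem closes (hA : AvoidanceLimit) (hS : SimpleSubseqLimits) (_hSplit : SlitSplitDischarge)
    (_hI : IsingBoundaryRatio) (_hSub : SubseqIdentification)
    (hT : EventualTight) (hDet : AvoidanceDeterminesLaw) (hPass : AvoidancePassage)
    (hCar : SLECarrier) (hVal : SLEAvoidanceValue) (hAsm : Assembly) :
    _root_.SAWScalingLimit :=
  hAsm hCar hVal hA hT hS hPass hDet

end Summit.CriticalPhenomena.SAWScalingLimit.Theses.SAWLoopFugacityFlow
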